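import Mathlib
import HarnessLib
import Literature.Analysis.FluidPDE.ParasiticSlabFlow
import Literature.Analysis.FluidPDE.LocalTypeI

/-!
# `ApexLocalisation` (crux stmt-NavierStokesRegularity-11719), line `decaying-ancient-bridge`:
# the finiteness `I < ⊤` is load-bearing in the slab compactness ENGINE `stub_slabCompactness`

Negative-side support (drefute seat, gen 2) for the lead's skeleton
`Cruxes/ApexLocalisation/Lines/decaying-ancient-bridge.lean` (registered 2026-08-16T00:22Z). Its engine
`stub_slabCompactness` (Albritton–Barker 2019 Lemma 2.2 + Prop. 2.3 exhausted to the slab) reads: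
for `I < ⊤`, suitable weak solutions `(v k, q k)` on the slab `(-∞,0) × ℝ³` with weak gradients `G k`
and `𝐈(v k, q k, G k) ≤ I` subconverge in `L³(Q(0,R))` for every `R > 0` to a suitable weak solution
with `𝐈 ≤ 4I`, singular at the origin if the approximants blow up in `L^∞(Q(0,R))` for every `R`.

This file records, sorry-free, that the hypothesis `I < ⊤` cannot be dropped:

* `SlabCompactnessWithoutFiniteI` — the engine with `I < ⊤` deleted (everything else verbatim);
* `eLpNorm_parasitic_cylinder_eq_top` — the parasitic flow `c e₀/√(−t)` (tree
  `Literature.Analysis.FluidPDE.ParasiticSlabFlow`, a suitable weak solution on the slab with the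
  Type-I rate and `𝐈 = ⊤`) has INFINITE `L³(Q(0,1))` norm for every `c ≠ 0`
  (`∫_{-1}^0 (−t)^{-3/2} dt = ∞`; proved by the lower bounds `|c|³ m · |B₁|` on `(−1/m², 0) × B₁`);
* `slabCompactness_false_without_finiteI : ¬ SlabCompactnessWithoutFiniteI` — with `I = ⊤` the family
  `v k = k e₀/√(−t)` is admissible, and no subsequence is `L³(Q(0,1))`-convergent to anything: two
  members of a convergent subsequence would be at finite `L³` distance, but their difference is again
  parasitic with non-zero amplitude, of infinite norm. (The limit `u` offered by the engine is
  measurable on the slab through its weak gradient, which is all the triangle inequality needs.)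

So any proof of the engine must use `I < ⊤` (it is what gives the uniform `L³`/`L^{3/2}` bounds fed to
`SuitableCompactness`), and the line cannot save hypotheses there.

## References

* D. Albritton, T. Barker, J. Math. Fluid Mech. 21 (2019) = arXiv:1811.00502, Lemma 2.2, Prop. 2.3.
  [AlbrittonBarker2019]
* G. Koch, N. Nadirashvili, G. Seregin, V. Šverák, Acta Math. 203 (2009), §1 p. 3 (parasitic
  solutions `b(t)`, `∇p = −b′(t)`). [KNSS2009]
-/

noncomputable section

open MeasureTheory TopologicalSpace Set Function Filter Topology Metric
open scoped ENNReal NNReal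
open Literature.Analysis Literature.Analysis.FluidPDE

set_option linter.dupNamespace false

namespace Summit.NavierStokesRegularity.NavierStokesRegularity.Theorems.ApexLocalisation.Negative

/-- Physical space. -/
local notation "ℝ³" => EuclideanSpace ℝ (Fin 3)

/-- The open backward slab `(-∞,0) × ℝ³` (time first), as in the route file. -/
local notation "𝕊" => Literature.Analysis.FluidPDE.slab (EuclideanSpace ℝ (Fin 3)) (Set.Iio (0 : ℝ)) isOpen_Iio

/-! ## §1 The engine without `I < ⊤` -/

/-- `stub_slabCompactness` of the line `decaying-ancient-bridge` with the hypothesis `I < ⊤` DELETED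
(all other binders, hypotheses and the conclusion verbatim). -/
def SlabCompactnessWithoutFiniteI : Prop :=
  ∀ (I : ℝ≥0∞) (v : ℕ → ℝ → ℝ³ → ℝ³) (q : ℕ → ℝ → ℝ³ → ℝ) (G : ℕ → ℝ → ℝ³ → ℝ³ →L[ℝ] ℝ³),
      (∀ k, IsSuitableWeakSolutionOn 𝕊 1 0 (v k) (q k)) →
      (∀ k, HasWeakSpatialGradientOn 𝕊 (v k) (G k)) →
      (∀ k, typeIBound (Iio (0 : ℝ) ×ˢ univ) (v k) (q k) (G k) ≤ I) →
      ∃ (u : ℝ → ℝ³ → ℝ³) (p : ℝ → ℝ³ → ℝ) (H : ℝ → ℝ³ → ℝ³ →L[ℝ] ℝ³) (σ : ℕ → ℕ),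
        StrictMono σ ∧
        IsSuitableWeakSolutionOn 𝕊 1 0 u p ∧
        HasWeakSpatialGradientOn 𝕊 u H ∧
        typeIBound (Iio (0 : ℝ) ×ˢ univ) u p H ≤ 4 * I ∧
        (∀ R : ℝ, 0 < R → Tendsto (fun j => eLpNorm (uncurry (v (σ j)) - uncurry u) 3
          (volume.restrict (parabolicCylinder R (0 : ℝ × ℝ³)))) atTop (𝓝 0)) ∧
        ((∀ R : ℝ, 0 < R → limsup (fun j => eLpNorm (uncurry (v (σ j))) ⊤
            (volume.restrict (parabolicCylinder R (0 : ℝ × ℝ³)))) atTop = ⊤) →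
          IsBackwardSingularPoint u 0)

/-! ## §2 The parasitic flow has infinite `L³(Q(0,1))` norm -/

/-- `‖c e₀/√(−t)‖ = |c|/√(−t)` for every real `c` (the tree's `norm_parasiticVelocity` assumes `0 ≤ c`). -/
theorem norm_parasiticVelocity_abs (c t : ℝ) (x : ℝ³) :
    ‖parasiticVelocity c t x‖ = |c| / Real.sqrt (-t) := by
  show ‖parasiticAmp c t • parasiticDir‖ = _
  rw [norm_smul, norm_parasiticDir, mul_one, parasiticAmp, Real.norm_eq_abs, abs_div,
    abs_of_nonneg (Real.sqrt_nonneg _)]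

/-- The difference of two parasitic flows is the parasitic flow of the difference of amplitudes. -/
theorem uncurry_parasiticVelocity_sub (a b : ℝ) :
    uncurry (parasiticVelocity a) - uncurry (parasiticVelocity b) =
      uncurry (parasiticVelocity (a - b)) := by
  funext z
  simp only [Pi.sub_apply, uncurry, parasiticVelocity, parasiticAmp, sub_div, sub_smul]

/-- The parasitic flow is (strongly) measurable on `ℝ × ℝ³`. -/
theorem measurable_uncurry_parasiticVelocity (c : ℝ) :
    Measurable (uncurry (parasiticVelocity c)) := by
  have h : uncurry (parasiticVelocity c) =
      fun z : ℝ × ℝ³ => (c / Real.sqrt (-z.1)) • parasiticDir := by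
    funext z; rfl
  rw [h]
  exact ((measurable_const.div (measurable_fst.neg.sqrt)).smul measurable_const)

/-- On `(−1/m², 0) × B₁` the parasitic flow is at least `|c| m` in norm. -/
theorem abs_mul_le_norm_parasiticVelocity {c t : ℝ} {m : ℕ} (hm : 1 ≤ m)
    (ht : t ∈ Ioo (-(1 / (m : ℝ) ^ 2)) 0) (x : ℝ³) :
    |c| * m ≤ ‖parasiticVelocity c t x‖ := by
  rw [norm_parasiticVelocity_abs]
  have hm0 : (0 : ℝ) < m := by exact_mod_cast hm
  have ht0 : 0 < -t := by linarith [ht.2]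
  have hs0 : 0 < Real.sqrt (-t) := Real.sqrt_pos.2 ht0
  have hsle : Real.sqrt (-t) ≤ 1 / (m : ℝ) := by
    rw [show (1 : ℝ) / m = Real.sqrt ((1 / (m : ℝ)) ^ 2) by
      rw [Real.sqrt_sq (by positivity)]]
    apply Real.sqrt_le_sqrt
    have := ht.1
    rw [one_div, inv_pow]; rw [one_div] at this
    linarith
  calc |c| * m = |c| / (1 / (m : ℝ)) := by field_simp
    _ ≤ |c| / Real.sqrt (-t) := div_le_div_of_nonneg_left (abs_nonneg c) hs0 hsle

/-- **The parasitic flow has infinite `L³(Q(0,1))` norm** for `c ≠ 0`: `∫_{Q(0,1)} |c|³(−t)^{−3/2} = ∞`. -/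
theorem eLpNorm_parasitic_cylinder_eq_top {c : ℝ} (hc : c ≠ 0) :
    eLpNorm (uncurry (parasiticVelocity c)) 3
      (volume.restrict (parabolicCylinder 1 (0 : ℝ × ℝ³))) = ⊤ := by
  have hp0 : (3 : ℝ≥0∞) ≠ 0 := by norm_num
  have hptop : (3 : ℝ≥0∞) ≠ ⊤ := ENNReal.ofNat_ne_top
  rw [eLpNorm_eq_lintegral_rpow_enorm_toReal hp0 hptop]
  have h3 : (3 : ℝ≥0∞).toReal = 3 := by norm_num
  rw [h3]
  suffices H : ∫⁻ z, ‖uncurry (parasiticVelocity c) z‖ₑ ^ (3 : ℝ)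
      ∂(volume.restrict (parabolicCylinder 1 (0 : ℝ × ℝ³))) = ⊤ by
    rw [H]
    exact ENNReal.top_rpow_of_pos (by norm_num)
  -- the ball volume
  set V : ℝ≥0∞ := volume (ball (0 : ℝ³) 1) with hV
  have hV0 : V ≠ 0 := (measure_ball_pos volume (0 : ℝ³) one_pos).ne'
  have hVtop : V ≠ ⊤ := measure_ball_lt_top.ne
  have hVpos : 0 < V.toReal := ENNReal.toReal_pos hV0 hVtop
  have hc3 : 0 < |c| ^ 3 := by positivity
  refine ENNReal.eq_top_of_forall_nnreal_le fun r => ?_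
  -- choose `m` with `|c|³ m |B₁| ≥ r`
  obtain ⟨m, hm⟩ := exists_nat_ge (max 1 ((r : ℝ) / (|c| ^ 3 * V.toReal)))
  have hm1 : (1 : ℝ) ≤ m := (le_max_left _ _).trans hm
  have hm1' : 1 ≤ m := by exact_mod_cast hm1
  have hmr : (r : ℝ) ≤ |c| ^ 3 * m * V.toReal := by
    have := (le_max_right _ _).trans hm
    rw [div_le_iff₀ (by positivity)] at this
    linarith
  -- the sub-box
  set S : Set (ℝ × ℝ³) := Ioo (-(1 / (m : ℝ) ^ 2)) 0 ×ˢ ball (0 : ℝ³) 1 with hS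
  have hSmeas : MeasurableSet S := measurableSet_Ioo.prod measurableSet_ball
  have hSsub : S ⊆ parabolicCylinder 1 (0 : ℝ × ℝ³) := by
    rintro ⟨t, x⟩ ⟨ht, hx⟩
    rw [mem_parabolicCylinder]
    refine ⟨⟨?_, by simpa using ht.2⟩, by simpa using hx⟩
    have hm0 : (0 : ℝ) < m := by linarith
    have : -(1 / (m : ℝ) ^ 2) ≥ -1 := by
      have : 1 / (m : ℝ) ^ 2 ≤ 1 := by
        rw [div_le_one (by positivity)]; nlinarith
      linarith
    simp only [Prod.fst_zero]
    linarith [ht.1]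
  have hvolS : volume S = ENNReal.ofReal (1 / (m : ℝ) ^ 2) * V := by
    rw [hS, Measure.volume_eq_prod, Measure.prod_prod, Real.volume_Ioo]
    congr 1
    ring_nf
  -- pointwise lower bound on `S`
  have hpt : ∀ z ∈ S, ENNReal.ofReal ((|c| * m) ^ (3 : ℝ)) ≤
      ‖uncurry (parasiticVelocity c) z‖ₑ ^ (3 : ℝ) := by
    rintro ⟨t, x⟩ ⟨ht, -⟩
    rw [← ENNReal.ofReal_rpow_of_nonneg (by positivity) (by norm_num)]
    refine ENNReal.rpow_le_rpow ?_ (by norm_num)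
    rw [← ofReal_norm]
    exact ENNReal.ofReal_le_ofReal (abs_mul_le_norm_parasiticVelocity hm1' ht x)
  -- assemble
  calc (r : ℝ≥0∞) = ENNReal.ofReal (r : ℝ) := ENNReal.ofReal_coe_nnreal.symm
    _ ≤ ENNReal.ofReal (|c| ^ 3 * m * V.toReal) := ENNReal.ofReal_le_ofReal hmr
    _ = ENNReal.ofReal ((|c| * m) ^ (3 : ℝ)) * (ENNReal.ofReal (1 / (m : ℝ) ^ 2) * V) := by
        rw [← mul_assoc, ← ENNReal.ofReal_mul (by positivity), ← ENNReal.ofReal_toReal hVtop,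
          ← ENNReal.ofReal_mul (by positivity), ENNReal.ofReal_toReal hVtop]
        congr 1
        rw [show ((3 : ℝ)) = ((3 : ℕ) : ℝ) by norm_num, Real.rpow_natCast]
        have hm0 : (m : ℝ) ≠ 0 := by positivity
        field_simp
    _ = ∫⁻ _ in S, ENNReal.ofReal ((|c| * m) ^ (3 : ℝ)) := by rw [setLIntegral_const, hvolS]
    _ ≤ ∫⁻ z in S, ‖uncurry (parasiticVelocity c) z‖ₑ ^ (3 : ℝ) := setLIntegral_mono' hSmeas hpt
    _ ≤ ∫⁻ z in parabolicCylinder 1 (0 : ℝ × ℝ³), ‖uncurry (parasiticVelocity c) z‖ₑ ^ (3 : ℝ) :=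
        lintegral_mono_set hSsub

/-! ## §3 The engine is false without `I < ⊤` -/

/-- The backward unit parabolic cylinder at the origin lies in the open slab. -/
theorem parabolicCylinder_subset_slab {R : ℝ} :
    parabolicCylinder R (0 : ℝ × ℝ³) ⊆ ((𝕊 : Opens (ℝ × ℝ³)) : Set (ℝ × ℝ³)) := by
  rintro ⟨t, x⟩ h
  rw [mem_parabolicCylinder] at h
  rw [coe_slab]
  exact ⟨by simpa using h.1.2, mem_univ _⟩

/-- **`I < ⊤` is load-bearing in `stub_slabCompactness`.** With `I = ⊤` the parasitic family
`v k = k e₀/√(−t)` (suitable weak on the slab, classical weak gradient `0`) is admissible, and no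
subsequence converges in `L³(Q(0,1))`: along a convergent subsequence two members would be at `L³`
distance `< 2`, whereas their difference is the parasitic flow with amplitude `σ J − σ (J+1) ≠ 0`, of
infinite `L³(Q(0,1))` norm (`eLpNorm_parasitic_cylinder_eq_top`). -/
theorem slabCompactness_false_without_finiteI : ¬ SlabCompactnessWithoutFiniteI := by
  intro h
  obtain ⟨u, p, H, σ, hσ, -, hgrad, -, hconv, -⟩ :=
    h ⊤ (fun k => parasiticVelocity (k : ℝ)) (fun k => parasiticPressure (k : ℝ))
      (fun k t x => fderiv ℝ (parasiticVelocity (k : ℝ) t) x)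
      (fun k => parasitic_isSuitableWeakSolutionOn (k : ℝ))
      (fun k => parasitic_hasWeakSpatialGradientOn (k : ℝ)) (fun k => le_top)
  set μ : Measure (ℝ × ℝ³) := volume.restrict (parabolicCylinder 1 (0 : ℝ × ℝ³)) with hμ
  -- the engine's limit is measurable on the cylinder (through its weak gradient on the slab)
  have hu : AEStronglyMeasurable (uncurry u) μ := by
    have h1 : AEStronglyMeasurable (uncurry u)
        (volume.restrict (((𝕊 : Opens (ℝ × ℝ³)) : Set (ℝ × ℝ³)))) :=
      hgrad.locallyIntegrableOn.aestronglyMeasurable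
    exact h1.mono_measure (Measure.restrict_mono parabolicCylinder_subset_slab le_rfl)
  have hv : ∀ c : ℝ, AEStronglyMeasurable (uncurry (parasiticVelocity c)) μ := fun c =>
    (measurable_uncurry_parasiticVelocity c).aestronglyMeasurable
  -- two members of the convergent subsequence at distance `< 1` from `u`
  have hev : ∀ᶠ j in atTop,
      eLpNorm (uncurry (parasiticVelocity ((σ j : ℕ) : ℝ)) - uncurry u) 3 μ < 1 :=
    (hconv 1 one_pos).eventually (gt_mem_nhds zero_lt_one)
  obtain ⟨J, hJ⟩ := eventually_atTop.1 hev
  have h1 := hJ J le_rfl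
  have h2 := hJ (J + 1) (Nat.le_succ J)
  -- their difference has finite norm …
  have hfin : eLpNorm (uncurry (parasiticVelocity ((σ J : ℕ) : ℝ)) -
      uncurry (parasiticVelocity ((σ (J + 1) : ℕ) : ℝ))) 3 μ < ⊤ := by
    have htri := eLpNorm_sub_le ((hv _).sub hu) ((hv ((σ (J + 1) : ℕ) : ℝ)).sub hu)
      (by norm_num : (1 : ℝ≥0∞) ≤ 3) (μ := μ)
      (f := uncurry (parasiticVelocity ((σ J : ℕ) : ℝ)) - uncurry u)
    have heq : uncurry (parasiticVelocity ((σ J : ℕ) : ℝ)) - uncurry u -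
        (uncurry (parasiticVelocity ((σ (J + 1) : ℕ) : ℝ)) - uncurry u) =
        uncurry (parasiticVelocity ((σ J : ℕ) : ℝ)) -
          uncurry (parasiticVelocity ((σ (J + 1) : ℕ) : ℝ)) := by abel
    rw [heq] at htri
    calc _ ≤ _ := htri
      _ < 1 + 1 := ENNReal.add_lt_add h1 h2
      _ < ⊤ := by norm_num
  -- … but it is parasitic with non-zero amplitude, hence of infinite norm
  have hne : ((σ J : ℕ) : ℝ) - ((σ (J + 1) : ℕ) : ℝ) ≠ 0 := by
    have hlt : σ J < σ (J + 1) := hσ (Nat.lt_succ_self J)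
    have : ((σ J : ℕ) : ℝ) < ((σ (J + 1) : ℕ) : ℝ) := by exact_mod_cast hlt
    linarith
  rw [uncurry_parasiticVelocity_sub, eLpNorm_parasitic_cylinder_eq_top hne] at hfin
  exact lt_irrefl _ hfin

end Summit.NavierStokesRegularity.NavierStokesRegularity.Theorems.ApexLocalisation.Negative
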